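import Literature.NumberTheory.IwasawaTheory.PSCyclotomicLFunction
import Literature.NumberTheory.EllipticCurves.PAdicLFunctionDistributionProofs
import HarnessLib

/-!
# The UNTWISTING IDENTITY for D1's double symbol sums: at conductor `pⁿ ≥ p^{2c}` the untwisted
# symbol sum is a Gauss sum times the ordinary twisted symbol sum —
# `∑_{a mod pⁿ} ∑_{b mod p^c} χ(a) η(b) [a/pⁿ + b/p^c]⁺_f = η(−1) · g(η, ψ_χ) · ∑_{a mod pⁿ} (χη)(a) [a/pⁿ]⁺_f`

Cell `pub/bsd-wall` (D-0145 line `route-BirchSwinnertonDyer-CyclotomicUntwist`), seat `bsd-line-cycu-p1`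
(prover seat 1/3, K1 base), helper toward crux K1 `PSRankOneLowerHalfAtThree`
(stmt-BirchSwinnertonDyer-21580). THEOREMS ONLY (no definition, no named fact, no `sorry`); BSD is not
proved by this file and no crux is.

WHAT IT DOES. Definition request D1 of the route (`Literature.NumberTheory.IwasawaTheory.PSCyclotomicLFunction`)
types the `3`-adic `L`-function of the UNTWIST `g = f ⊗ η̄` through the predicate
`IsUntwistedPAdicLFunction p f η α μ`, whose interpolation clause is written in the rational plus symbols
of `f` via the DOUBLE sum `untwistSymbolSum p f η χ = ∑_{a mod pⁿ} ∑_{b mod p^c} χ(a) η(b) [a/pⁿ + b/p^c]⁺_f`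
(`χ` = the primitive character of `η̄ξ`). Its module docstring EXPLAINS (does not prove) that this double
sum is, up to a Gauss sum, the twisted special value `τ(ξ̄η…) L(f, ξ̄, 1)/Ω⁺_f`. This file PROVES the
finite, character-theoretic half of that explanation, for every prime `p`, every `c ≥ 1`, every level
`n ≥ 2c`, every `η` mod `p^c` and every `χ` mod `pⁿ` (no primitivity needed), and any cusp form `f`:

  `untwistSymbolSum p f η χ = η(−1) · gaussSum η ψ · ratTwistedSymbolSum f (χ · η↑)`     (★)

where `η↑ = changeLevel η` to level `pⁿ`, `ratTwistedSymbolSum f ξ = ∑_{a mod pⁿ} ξ(a) [a/pⁿ]⁺_f` is the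
tree's ORDINARY twisted symbol sum (`Literature.NumberTheory.EllipticCurves.ratTwistedSymbolSum`, the
left side of Birch's formula `ratTwistedSymbolSum_mul_plusPeriod`: `(∑ ξ(a)[a/m]⁺) Ω⁺_f = τ(ξ) L(f, ξ̄, 1)`),
and `ψ = ψ_χ` is the ADDITIVE character `y ↦ χ(1 + p^{n−c} y)` of `ℤ/p^c` (additive exactly because
`2(n − c) ≥ n`; `exists_addChar_eq`). Proof: `[a/pⁿ + b/p^c]⁺ = [(a + p^{n−c}b)/pⁿ]⁺` (`[r + 1]⁺ = [r]⁺`,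
tree `ratPlusSymbol_add_intCast_eq`); re-index `a ↦ a + p^{n−c}b`; for a unit `a`,
`χ(a − p^{n−c}b) = χ(a) ψ(−b ā⁻¹)` and `∑_b η(b) ψ(−b ā⁻¹) = η(−1) η(ā) g(η, ψ)` (re-index `b ↦ −ā b`); for a
non-unit `a` both sides vanish.

CONSEQUENCES (§5). For `μ` with `IsUntwistedPAdicLFunction p f η α μ` and `ξ` primitive even of `p`-power
order and conductor `pⁿ`, `n ≥ 2c`, with `χ` the primitive character of `η̄ξ` at level `pⁿ`:
`∫_Γ ξ dμ = e_n(α) · η(−1) · g(η, ψ_χ) · ratTwistedSymbolSum f ξ` (`gammaCharValue_eq_of_conductor_ge`) —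
D1's interpolation clause at every wild enough character IS the Mazur–Tate–Teitelbaum shape
`e_n(α) × (Gauss sum) × ∑ ξ(a)[a/pⁿ]⁺_f`, hence (Birch) `∝ L(f, ξ̄, 1)/Ω⁺_f`. For the route (`p = 3`, `c = 2`)
this covers every `ξ` of conductor `≥ 81`; the two tame levels `9, 27` and `ξ = 𝟙` (cycu-p2's
`CyclotomicUntwistValueAtOne.value_at_one`) are finite bookkeeping outside (★)'s hypothesis `n ≥ 2c`.
What (★) is FOR: any use of D1 beyond `ξ = 𝟙` — existence of `𝓛^η` (the route's F1), its non-vanishing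
from Rohrlich-type theorems, a functional equation — passes through (★); none of those is claimed here.

References: [cite: MazurTateTeitelbaum1986Invent, §I.8 (8.6) and §I.14 (case p ∣ N)];
[cite: Bellaiche2021, Thm. 6.7.9]; Gauss-sum re-indexing [folklore].
-/

noncomputable section

open scoped MatrixGroups ModularForm

open CongruenceSubgroup DirichletCharacter Literature.NumberTheory.EllipticCurves
  Literature.NumberTheory.EllipticCurves.ModularForms Literature.NumberTheory.IwasawaTheory

-- single-conjunct summit: `Summit.BirchSwinnertonDyer.BirchSwinnertonDyer.…` repeats the name by design
set_option linter.dupNamespace false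
set_option autoImplicit false

namespace Summit.BirchSwinnertonDyer.BirchSwinnertonDyer.Theorems.PSUntwisting

variable {p : ℕ} [Fact p.Prime]

/-! ### §1 Arithmetic in `ℤ/pⁿ`: units, the nilpotent `t = p^{n−c}`, reduction to `ℤ/p^c` -/

section ZModPow

variable {n : ℕ}

/-- In `ℤ/pⁿ` (`n ≥ 1`) an element is a unit iff its canonical representative is prime to `p`. [folklore] -/
theorem isUnit_iff_coprime_val (hn : 0 < n) (x : ZMod (p ^ n)) : IsUnit x ↔ x.val.Coprime p := by
  haveI : NeZero (p ^ n) := ⟨pow_ne_zero _ (Fact.out : p.Prime).ne_zero⟩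
  rw [← ZMod.natCast_zmod_val x, ZMod.isUnit_iff_coprime, ZMod.val_natCast, Nat.mod_eq_of_lt x.val_lt,
    Nat.coprime_pow_right_iff hn]

/-- Units of `ℤ/pⁿ` are detected modulo `p`: `x` is a unit iff its image in `ℤ/p` is. [folklore] -/
theorem isUnit_iff_isUnit_castHom (hn : 0 < n) (x : ZMod (p ^ n)) :
    IsUnit x ↔ IsUnit (ZMod.castHom (dvd_pow_self p hn.ne') (ZMod p) x) := by
  haveI : NeZero (p ^ n) := ⟨pow_ne_zero _ (Fact.out : p.Prime).ne_zero⟩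
  rw [isUnit_iff_coprime_val hn, ZMod.castHom_apply, ← ZMod.natCast_val, ZMod.isUnit_iff_coprime]

omit [Fact p.Prime] in
/-- `p^k = 0` in `ℤ/pⁿ` once `n ≤ k`. [folklore] -/
theorem natCast_pow_eq_zero_of_le {k : ℕ} (hk : n ≤ k) : ((p ^ k : ℕ) : ZMod (p ^ n)) = 0 := by
  rw [ZMod.natCast_eq_zero_iff]
  exact pow_dvd_pow p hk

/-- Perturbing by a multiple of `t = p^{n−c}` (`c < n`) does not change unit-hood. [folklore] -/
theorem isUnit_sub_mul_iff {c : ℕ} (hcn : c < n) (x y : ZMod (p ^ n)) :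
    IsUnit (x - ((p ^ (n - c) : ℕ) : ZMod (p ^ n)) * y) ↔ IsUnit x := by
  have hn : 0 < n := lt_of_le_of_lt (Nat.zero_le c) hcn
  rw [isUnit_iff_isUnit_castHom hn, isUnit_iff_isUnit_castHom hn x, map_sub, map_mul, map_natCast]
  have h0 : ((p ^ (n - c) : ℕ) : ZMod p) = 0 := by
    rw [ZMod.natCast_eq_zero_iff]
    exact dvd_pow_self p (Nat.sub_ne_zero_of_lt hcn)
  rw [h0, zero_mul, sub_zero]

/-- `t · X` depends only on `X mod p^c` (`t = p^{n−c}`, `c ≤ n`): the reduction map to `ℤ/p^c`. [folklore] -/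
theorem mul_eq_mul_of_castHom_eq {c : ℕ} (hcn : c ≤ n) {X Y : ZMod (p ^ n)}
    (h : ZMod.castHom (pow_dvd_pow p hcn) (ZMod (p ^ c)) X =
      ZMod.castHom (pow_dvd_pow p hcn) (ZMod (p ^ c)) Y) :
    ((p ^ (n - c) : ℕ) : ZMod (p ^ n)) * X = ((p ^ (n - c) : ℕ) : ZMod (p ^ n)) * Y := by
  haveI : NeZero (p ^ n) := ⟨pow_ne_zero _ (Fact.out : p.Prime).ne_zero⟩
  rw [← sub_eq_zero, ← mul_sub]
  have hd : ZMod.castHom (pow_dvd_pow p hcn) (ZMod (p ^ c)) (X - Y) = 0 := by rw [map_sub, h, sub_self]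
  -- `X - Y` is represented by a multiple of `p^c`
  rw [← ZMod.natCast_zmod_val (X - Y)] at hd ⊢
  rw [map_natCast, ZMod.natCast_eq_zero_iff] at hd
  obtain ⟨q, hq⟩ := hd
  rw [hq, ← Nat.cast_mul, ← mul_assoc, ← pow_add, Nat.sub_add_cancel hcn, Nat.cast_mul,
    ZMod.natCast_self, zero_mul]

/-- The reduction of the canonical lift: `castHom (y.val : ℤ/pⁿ) = y` for `y ∈ ℤ/p^c`. [folklore] -/
theorem castHom_natCast_val {c : ℕ} (hcn : c ≤ n) (y : ZMod (p ^ c)) :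
    ZMod.castHom (pow_dvd_pow p hcn) (ZMod (p ^ c)) ((y.val : ℕ) : ZMod (p ^ n)) = y := by
  haveI : NeZero (p ^ c) := ⟨pow_ne_zero _ (Fact.out : p.Prime).ne_zero⟩
  rw [map_natCast, ZMod.natCast_zmod_val]

omit [Fact p.Prime] in
/-- `t² = 0` in `ℤ/pⁿ` when `2(n − c) ≥ n`, i.e. `2c ≤ n`. [folklore] -/
theorem natCast_pow_sub_mul_self {c : ℕ} (h2 : 2 * c ≤ n) :
    ((p ^ (n - c) : ℕ) : ZMod (p ^ n)) * ((p ^ (n - c) : ℕ) : ZMod (p ^ n)) = 0 := by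
  rw [← Nat.cast_mul, ← pow_add]
  exact natCast_pow_eq_zero_of_le (by omega)

end ZModPow

/-! ### §2 The additive character `ψ_χ : y ↦ χ(1 + p^{n−c} y)` of `ℤ/p^c` (`2c ≤ n`) -/

section AddCharacter

variable {c n : ℕ} (χ : DirichletCharacter ℂ_[p] (p ^ n))

/-- **`y ↦ χ(1 + p^{n−c}·y)` is an additive character of `ℤ/p^c` when `2c ≤ n`** (then
`(1 + tY)(1 + tZ) = 1 + t(Y + Z)` since `t² = p^{2(n−c)} = 0 mod pⁿ`). Stated as an existence so that no
definition is introduced. [folklore] -/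
theorem exists_addChar_eq (hcn : c ≤ n) (h2 : 2 * c ≤ n) :
    ∃ ψ : AddChar (ZMod (p ^ c)) ℂ_[p],
      ∀ y : ZMod (p ^ c), ψ y = χ (1 + ((p ^ (n - c) : ℕ) : ZMod (p ^ n)) * ((y.val : ℕ) : ZMod (p ^ n))) := by
  haveI : NeZero (p ^ c) := ⟨pow_ne_zero _ (Fact.out : p.Prime).ne_zero⟩
  set t : ZMod (p ^ n) := ((p ^ (n - c) : ℕ) : ZMod (p ^ n)) with ht
  refine ⟨{ toFun := fun y ↦ χ (1 + t * ((y.val : ℕ) : ZMod (p ^ n)))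
            map_zero_eq_one' := by simp
            map_add_eq_mul' := fun y z ↦ ?_ }, fun y ↦ rfl⟩
  -- additivity of the lift up to `t`-multiples, then `t² = 0`
  have hadd : t * (((y + z).val : ℕ) : ZMod (p ^ n)) =
      t * (((y.val : ℕ) : ZMod (p ^ n)) + ((z.val : ℕ) : ZMod (p ^ n))) := by
    refine mul_eq_mul_of_castHom_eq hcn ?_
    rw [castHom_natCast_val hcn, map_add, castHom_natCast_val hcn, castHom_natCast_val hcn]
  show χ _ = χ _ * χ _
  rw [← map_mul, hadd]
  congr 1
  have ht2 : t * t = 0 := natCast_pow_sub_mul_self h2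
  linear_combination (-(((y.val : ℕ) : ZMod (p ^ n)) * ((z.val : ℕ) : ZMod (p ^ n)))) * ht2

end AddCharacter

/-! ### §3 The symbols: `[a/pⁿ + b/p^c]⁺ = [(a + p^{n−c}b)/pⁿ]⁺` -/

section Symbols

variable {N : ℕ} [NeZero N] (f : CuspForm (Gamma0 N) 2)

/-- `[m/pⁿ]⁺_f` depends only on `m mod pⁿ` (`[r + k]⁺ = [r]⁺`, `ratPlusSymbol_add_intCast_eq`).
[cite: MazurTateTeitelbaum1986Invent, §I.4 (4.2)] -/
theorem ratPlusSymbol_natCast_div_pow (n m : ℕ) :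
    ratPlusSymbol f ((m : ℚ) / (p : ℚ) ^ n) =
      ratPlusSymbol f ((((m : ZMod (p ^ n)).val : ℕ) : ℚ) / (p : ℚ) ^ n) := by
  have hp : (p : ℚ) ^ n ≠ 0 := pow_ne_zero _ (Nat.cast_ne_zero.mpr (Fact.out : p.Prime).ne_zero)
  rw [ZMod.val_natCast]
  have h : ((m % p ^ n : ℕ) : ℚ) + (p : ℚ) ^ n * ((m / p ^ n : ℕ) : ℚ) = (m : ℚ) := by
    exact_mod_cast Nat.mod_add_div m (p ^ n)
  have hm : (m : ℚ) / (p : ℚ) ^ n = ((m % p ^ n : ℕ) : ℚ) / (p : ℚ) ^ n + (((m / p ^ n : ℕ) : ℤ) : ℚ) := by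
    rw [Int.cast_natCast, ← h, add_div, mul_div_cancel_left₀ _ hp]
  rw [hm, ratPlusSymbol_add_intCast_eq]

/-- **The symbol of the double sum**: for `a ∈ ℤ/pⁿ`, `b ∈ ℤ/p^c`, `c ≤ n`,
`[a/pⁿ + b/p^c]⁺_f = [x/pⁿ]⁺_f` with `x = a + p^{n−c}·b ∈ ℤ/pⁿ` (representatives in `[0, pⁿ)`).
[cite: MazurTateTeitelbaum1986Invent, §I.4 (4.2)] -/
theorem ratPlusSymbol_double_eq {c n : ℕ} (hcn : c ≤ n) (a : ZMod (p ^ n)) (b : ZMod (p ^ c)) :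
    ratPlusSymbol f ((a.val : ℚ) / (p : ℚ) ^ n + (b.val : ℚ) / (p : ℚ) ^ c) =
      ratPlusSymbol f ((((a + ((p ^ (n - c) : ℕ) : ZMod (p ^ n)) * ((b.val : ℕ) : ZMod (p ^ n))).val : ℕ) : ℚ) /
        (p : ℚ) ^ n) := by
  haveI : NeZero (p ^ n) := ⟨pow_ne_zero _ (Fact.out : p.Prime).ne_zero⟩
  have hp0 : (p : ℚ) ≠ 0 := Nat.cast_ne_zero.mpr (Fact.out : p.Prime).ne_zero
  have hsum : (a.val : ℚ) / (p : ℚ) ^ n + (b.val : ℚ) / (p : ℚ) ^ c =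
      ((a.val + p ^ (n - c) * b.val : ℕ) : ℚ) / (p : ℚ) ^ n := by
    have hpow : (p : ℚ) ^ n = (p : ℚ) ^ (n - c) * (p : ℚ) ^ c := by
      rw [← pow_add, Nat.sub_add_cancel hcn]
    push_cast
    rw [hpow]
    field_simp
  rw [hsum, ratPlusSymbol_natCast_div_pow f n]
  congr 3
  push_cast
  rw [ZMod.natCast_zmod_val]

end Symbols

/-! ### §4 The inner character sums and the untwisting identity (★) -/

section Identity

variable {N : ℕ} [NeZero N] (f : CuspForm (Gamma0 N) 2)
variable {c n : ℕ} (η : DirichletCharacter ℂ_[p] (p ^ c)) (χ : DirichletCharacter ℂ_[p] (p ^ n))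

/-- The inner character sum at a NON-unit vanishes: `∑_b η(b) χ(a − p^{n−c} b) = 0` for `a ∉ (ℤ/pⁿ)ˣ`
(`c < n`: each argument is a non-unit). [folklore] -/
theorem inner_sum_eq_zero_of_not_isUnit (hcn : c < n) {a : ZMod (p ^ n)} (ha : ¬ IsUnit a) :
    ∑ b : ZMod (p ^ c), η b * χ (a - ((p ^ (n - c) : ℕ) : ZMod (p ^ n)) * ((b.val : ℕ) : ZMod (p ^ n))) = 0 := by
  refine Finset.sum_eq_zero fun b _ ↦ ?_
  rw [χ.map_nonunit (fun h ↦ ha ((isUnit_sub_mul_iff hcn a _).mp h)), mul_zero]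

/-- The inner character sum at a UNIT: `∑_b η(b) χ(u − p^{n−c} b) = χ(u) η(−1) η(ū) g(η, ψ)`, where
`ū` is `u mod p^c` and `ψ(y) = χ(1 + p^{n−c} y)` (re-index `b ↦ −ū·b`). [folklore] -/
theorem inner_sum_eq_of_isUnit (hcn : c ≤ n) (ψ : AddChar (ZMod (p ^ c)) ℂ_[p])
    (hψ : ∀ y : ZMod (p ^ c), ψ y = χ (1 + ((p ^ (n - c) : ℕ) : ZMod (p ^ n)) * ((y.val : ℕ) : ZMod (p ^ n))))
    (u : (ZMod (p ^ n))ˣ) :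
    ∑ b : ZMod (p ^ c), η b * χ ((u : ZMod (p ^ n)) - ((p ^ (n - c) : ℕ) : ZMod (p ^ n)) * ((b.val : ℕ) : ZMod (p ^ n))) =
      χ u * η (-1) * η (ZMod.castHom (pow_dvd_pow p hcn) (ZMod (p ^ c)) u) * gaussSum η ψ := by
  haveI : NeZero (p ^ c) := ⟨pow_ne_zero _ (Fact.out : p.Prime).ne_zero⟩
  haveI : NeZero (p ^ n) := ⟨pow_ne_zero _ (Fact.out : p.Prime).ne_zero⟩
  set π := ZMod.castHom (pow_dvd_pow p hcn) (ZMod (p ^ c)) with hπ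
  set t : ZMod (p ^ n) := ((p ^ (n - c) : ℕ) : ZMod (p ^ n)) with ht
  -- the reduced unit `ū = u mod p^c`
  set ub : (ZMod (p ^ c))ˣ := Units.map (π : ZMod (p ^ n) →* ZMod (p ^ c)) u with hub
  have hub_val : (ub : ZMod (p ^ c)) = π u := rfl
  have hub_inv : π ((u⁻¹ : (ZMod (p ^ n))ˣ) : ZMod (p ^ n)) = ((ub⁻¹ : (ZMod (p ^ c))ˣ) : ZMod (p ^ c)) := rfl
  -- each term: `χ(u − t b) = χ u · ψ(−b ū⁻¹)`
  have hterm : ∀ b : ZMod (p ^ c),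
      χ ((u : ZMod (p ^ n)) - t * ((b.val : ℕ) : ZMod (p ^ n))) = χ u * ψ (-(b * (ub⁻¹ : (ZMod (p ^ c))ˣ))) := by
    intro b
    set y : ZMod (p ^ c) := -(b * (ub⁻¹ : (ZMod (p ^ c))ˣ)) with hy
    have hlift : t * ((y.val : ℕ) : ZMod (p ^ n)) =
        -(t * (((b.val : ℕ) : ZMod (p ^ n)) * (u⁻¹ : (ZMod (p ^ n))ˣ))) := by
      rw [← mul_neg]
      refine mul_eq_mul_of_castHom_eq hcn ?_
      rw [castHom_natCast_val hcn, map_neg, map_mul, castHom_natCast_val hcn, hub_inv, hy]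
    have hu : (u : ZMod (p ^ n)) * (u⁻¹ : (ZMod (p ^ n))ˣ) = 1 := Units.mul_inv u
    have hfac : (u : ZMod (p ^ n)) - t * ((b.val : ℕ) : ZMod (p ^ n)) =
        u * (1 + t * ((y.val : ℕ) : ZMod (p ^ n))) := by
      linear_combination (-(u : ZMod (p ^ n))) * hlift + (t * ((b.val : ℕ) : ZMod (p ^ n))) * hu
    rw [hfac, map_mul, hψ y]
  simp_rw [hterm]
  -- re-index `b ↦ −ū·b'`
  have hre : ∑ b : ZMod (p ^ c), η b * (χ u * ψ (-(b * (ub⁻¹ : (ZMod (p ^ c))ˣ)))) =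
      ∑ b' : ZMod (p ^ c), η (-(ub : ZMod (p ^ c)) * b') * (χ u * ψ b') := by
    refine Fintype.sum_equiv (Units.mulLeft (-ub⁻¹)) _ _ fun b ↦ ?_
    simp only [Units.mulLeft_apply, Units.val_neg]
    congr 2
    · rw [← mul_assoc, neg_mul_neg, Units.mul_inv, one_mul]
    · rw [neg_mul, mul_comm]
  rw [hre]
  have hsplit : ∀ b' : ZMod (p ^ c), η (-(ub : ZMod (p ^ c)) * b') * (χ u * ψ b') =
      (χ u * η (-1) * η (ub : ZMod (p ^ c))) * (η b' * ψ b') := by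
    intro b'
    rw [show -(ub : ZMod (p ^ c)) * b' = (-1) * (ub : ZMod (p ^ c)) * b' by ring, map_mul, map_mul]
    ring
  simp_rw [hsplit, ← Finset.mul_sum]
  rw [gaussSum, hub_val]

/-- **THE UNTWISTING IDENTITY (★).** For a prime `p`, levels `1 ≤ c`, `2c ≤ n`, Dirichlet characters `η`
mod `p^c` and `χ` mod `pⁿ` with values in `ℂ_p`, the additive character `ψ(y) = χ(1 + p^{n−c}y)` of
`ℤ/p^c` (`exists_addChar_eq`) and any cusp form `f` on `Γ₀(N)`:
`∑_{a mod pⁿ} ∑_{b mod p^c} χ(a) η(b) [a/pⁿ + b/p^c]⁺_f = η(−1) · g(η, ψ) · ∑_{a mod pⁿ} (χ η)(a) [a/pⁿ]⁺_f`,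
i.e. D1's `untwistSymbolSum p f η χ` is `η(−1) · gaussSum η ψ · ratTwistedSymbolSum f (χ · η↑)`.
[cite: MazurTateTeitelbaum1986Invent, §I.8 (8.6) and §I.14 (case p ∣ N)] -/
theorem untwistSymbolSum_eq (hc : 0 < c) (h2 : 2 * c ≤ n) (ψ : AddChar (ZMod (p ^ c)) ℂ_[p])
    (hψ : ∀ y : ZMod (p ^ c), ψ y = χ (1 + ((p ^ (n - c) : ℕ) : ZMod (p ^ n)) * ((y.val : ℕ) : ZMod (p ^ n)))) :
    untwistSymbolSum p f η χ =
      η (-1) * gaussSum η ψ *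
        ratTwistedSymbolSum f (χ * changeLevel (pow_dvd_pow p (by omega : c ≤ n)) η) := by
  have hcn : c ≤ n := by omega
  have hcn' : c < n := by omega
  haveI : NeZero (p ^ n) := ⟨pow_ne_zero _ (Fact.out : p.Prime).ne_zero⟩
  haveI : NeZero (p ^ c) := ⟨pow_ne_zero _ (Fact.out : p.Prime).ne_zero⟩
  set t : ZMod (p ^ n) := ((p ^ (n - c) : ℕ) : ZMod (p ^ n)) with ht
  -- the level-`pⁿ` symbol, read in `ℂ_p`
  set A : ZMod (p ^ n) → ℂ_[p] := fun x ↦ algebraMap ℚ ℂ_[p] (ratPlusSymbol f ((x.val : ℚ) / (p : ℚ) ^ n))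
    with hA
  -- Step 1: the double sum with the symbol of the shifted numerator
  have h1 : untwistSymbolSum p f η χ =
      ∑ a : ZMod (p ^ n), ∑ b : ZMod (p ^ c), χ a * η b * A (a + t * ((b.val : ℕ) : ZMod (p ^ n))) := by
    unfold untwistSymbolSum
    refine Finset.sum_congr rfl fun a _ ↦ Finset.sum_congr rfl fun b _ ↦ ?_
    rw [ratPlusSymbol_double_eq f hcn a b]
  -- Step 2: swap and re-index `a ↦ a + t b`
  have h2 : ∑ a : ZMod (p ^ n), ∑ b : ZMod (p ^ c), χ a * η b * A (a + t * ((b.val : ℕ) : ZMod (p ^ n))) =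
      ∑ a' : ZMod (p ^ n), A a' *
        ∑ b : ZMod (p ^ c), η b * χ (a' - t * ((b.val : ℕ) : ZMod (p ^ n))) := by
    rw [Finset.sum_comm]
    have hre : ∀ b : ZMod (p ^ c),
        ∑ a : ZMod (p ^ n), χ a * η b * A (a + t * ((b.val : ℕ) : ZMod (p ^ n))) =
          ∑ a' : ZMod (p ^ n), χ (a' - t * ((b.val : ℕ) : ZMod (p ^ n))) * η b * A a' := fun b ↦
      Fintype.sum_equiv (Equiv.addRight (t * ((b.val : ℕ) : ZMod (p ^ n)))) _ _ fun a ↦ by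
        simp only [Equiv.coe_addRight, add_sub_cancel_right]
    rw [Finset.sum_congr rfl fun b _ ↦ hre b, Finset.sum_comm]
    refine Finset.sum_congr rfl fun a' _ ↦ ?_
    rw [Finset.mul_sum]
    exact Finset.sum_congr rfl fun b _ ↦ by ring
  -- Step 3: evaluate the inner sums
  rw [h1, h2, ratTwistedSymbolSum, Finset.mul_sum]
  refine Finset.sum_congr rfl fun a' _ ↦ ?_
  have hAa : (ratPlusSymbol f ((a'.val : ℚ) / ((p ^ n : ℕ) : ℚ)) : ℂ_[p]) = A a' := by
    simp only [hA, eq_ratCast, Nat.cast_pow]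
  rw [hAa, MulChar.mul_apply]
  by_cases ha : IsUnit a'
  · obtain ⟨u, rfl⟩ := ha
    rw [inner_sum_eq_of_isUnit η χ hcn ψ hψ u, changeLevel_eq_cast_of_dvd η (pow_dvd_pow p hcn),
      ZMod.castHom_apply]
    ring
  · rw [inner_sum_eq_zero_of_not_isUnit η χ hcn' ha, χ.map_nonunit ha]
    ring

end Identity

/-! ### §5 Consequence for D1: the interpolation values at conductor `pⁿ ≥ p^{2c}` -/

section Interpolation

variable {N : ℕ} [NeZero N] {f : CuspForm (Gamma0 N) 2}
variable {c : ℕ} {η : DirichletCharacter ℂ_[p] (p ^ c)} {α : ℂ_[p]} {μ : (n : ℕ) → ZMod (p ^ n) → ℂ_[p]}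

/-- On units, `χ · η↑ = ξ` when `χ` agrees with `η⁻¹ξ` on the integers prime to `p` (D1's compatibility
clause); as Dirichlet characters of the same level they are then EQUAL. [folklore] -/
theorem mul_changeLevel_eq_of_compat {n : ℕ} (hc : 0 < c) (hcn : c ≤ n)
    (χ ξ : DirichletCharacter ℂ_[p] (p ^ n))
    (hχ : ∀ a : ℕ, a.Coprime p → χ (a : ZMod (p ^ n)) = (η (a : ZMod (p ^ c)))⁻¹ * ξ (a : ZMod (p ^ n))) :
    χ * changeLevel (pow_dvd_pow p hcn) η = ξ := by
  haveI : NeZero (p ^ n) := ⟨pow_ne_zero _ (Fact.out : p.Prime).ne_zero⟩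
  haveI : NeZero (p ^ c) := ⟨pow_ne_zero _ (Fact.out : p.Prime).ne_zero⟩
  have hn : 0 < n := lt_of_lt_of_le hc hcn
  apply MulChar.ext
  intro u
  have hcop : (u : ZMod (p ^ n)).val.Coprime p := (isUnit_iff_coprime_val hn _).mp u.isUnit
  have hηu : IsUnit (η (((u : ZMod (p ^ n)).val : ℕ) : ZMod (p ^ c))) := by
    refine IsUnit.map η ?_
    rw [ZMod.isUnit_iff_coprime]
    exact (Nat.coprime_pow_right_iff hc _ _).mpr hcop
  rw [MulChar.mul_apply, changeLevel_eq_cast_of_dvd, ← ZMod.natCast_zmod_val (u : ZMod (p ^ n)),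
    ZMod.cast_natCast (pow_dvd_pow p hcn), hχ _ hcop, mul_comm ((η _)⁻¹) _, mul_assoc,
    inv_mul_cancel₀ hηu.ne_zero, mul_one]

/-- **D1's interpolation value at a character of conductor `pⁿ ≥ p^{2c}` is the Mazur–Tate–Teitelbaum
shape.** If `μ` has the D1 property `IsUntwistedPAdicLFunction p f η α μ` (`c ≥ 1`), then for every
primitive even `ξ` mod `pⁿ` of `p`-power order with `n ≥ 2c`, every primitive `χ` mod `pⁿ` agreeing with
`η⁻¹ξ` off `p`, and `ψ(y) = χ(1 + p^{n−c}y)`: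
`∫_Γ ξ dμ = e_n(α) · η(−1) · g(η, ψ) · ∑_{a mod pⁿ} ξ(a) [a/pⁿ]⁺_f` — the untwist multiplier times a Gauss
sum times the ORDINARY twisted symbol sum of `f` at `ξ`, whose value is `τ(ξ) L(f, ξ̄, 1)/Ω⁺_f` by Birch's
formula (`ratTwistedSymbolSum_mul_plusPeriod`, not invoked here).
[cite: MazurTateTeitelbaum1986Invent, §I.14 (case p ∣ N)] [cite: Bellaiche2021, Thm. 6.7.9] -/
theorem gammaCharValue_eq_of_conductor_ge (hμ : IsUntwistedPAdicLFunction p f η α μ) (hc : 0 < c)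
    {n : ℕ} (h2 : 2 * c ≤ n) (ξ : DirichletCharacter ℂ_[p] (p ^ n)) (hξ : ξ.IsPrimitive) (hξe : ξ.Even)
    (hξo : ∃ j : ℕ, orderOf ξ = p ^ j) (χ : DirichletCharacter ℂ_[p] (p ^ n)) (hχ : χ.IsPrimitive)
    (hcompat : ∀ a : ℕ, a.Coprime p → χ (a : ZMod (p ^ n)) = (η (a : ZMod (p ^ c)))⁻¹ * ξ (a : ZMod (p ^ n)))
    (ψ : AddChar (ZMod (p ^ c)) ℂ_[p])
    (hψ : ∀ y : ZMod (p ^ c), ψ y = χ (1 + ((p ^ (n - c) : ℕ) : ZMod (p ^ n)) * ((y.val : ℕ) : ZMod (p ^ n)))) :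
    gammaCharValue p μ ξ = untwistMultiplier p α n * (η (-1) * gaussSum η ψ * ratTwistedSymbolSum f ξ) := by
  obtain ⟨-, -, hint⟩ := hμ
  rw [hint n ξ hξ hξe hξo n χ hχ hcompat, untwistSymbolSum_eq f η χ hc h2 ψ hψ,
    mul_changeLevel_eq_of_compat hc (by omega) χ ξ hcompat]

end Interpolation

end Summit.BirchSwinnertonDyer.BirchSwinnertonDyer.Theorems.PSUntwisting
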